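import Summits.QuantumFields.BalabanUV.Beta.GAN24.Lin4LegTowerUnroll
import Summits.QuantumFields.BalabanUV.Beta.GAN24.TowerBoundKFold

/-!
# `BalabanUV.Beta.GAN24.LegTowerRows` — binder row G-an2-4 ∕ (CONV-C), CT-W, located crux (Q-L) («QL-LL», RULING R-gan24p1-g25-1 R10 (iii), WARD6 (9.3)):
# **THE (Q-L) END, STATEMENT FIRST** — the right-divergenced leg tower of the affine `lin4` recursion is bounded UNIFORMLY IN THE LEVEL in any subadditive size,
# GIVEN the one displayed k₀-window hypothesis «the k₀-fold pure leg chain on k₀-fold block sums contracts» ((WIN-k₀) ∧ (LT-leg) combined — OPEN) and bounded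
# window sources (G-an2-4 formalisation swarm, leaf prover `b2b-balaban-gan24-formalise-leaf-03`, gen 60; (REP-leg) parts 1–3 `Lin4LegTower{,Two,Unroll}` ✓ + the OWNER
# gan24-p1 g25's socket `TowerBoundKFold` ✓ BY NAME; the (Q-L) twin of the OWNER's (Q-R) END `WardRemainderRows`; name PROVISIONAL)

NOT IN PRINT; OUR BOOKKEEPING ([folklore]: one re-basing of leaf-01's discrete Duhamel + the OWNER's k₀-fold tower bound; 0 def, 0 cite, 0 `def … : Prop`, 0 sorry).
HONEST FRAMING (cell contract, verbatim): «discharging `BetaPertH` makes Bałaban's UV stability UNCONDITIONAL — a real constructive-QFT result; it is NOT the continuum limit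
and NOT the Clay problem.»  HONEST DEPENDENCY (verbatim): «continuum YM on T⁴ ⇐ BetaPertH ∧ nine spine estimates (0/9 proved); BetaPertH ⇐ (D1) ∧ (D4) ∧ CAP+tail;
G-an2-4 gates asym, D1 and NE2/3/4.»
* §1 `rdiv_tower_window` — THE k₀-WINDOW FORM: for the tower `Δ n = fun s ↦ rdiv (T n s)` with the closed one-step law at every level,
  `Δ (n + k) = transport (legStepB kc K N) n k (Δ n) + Σ_{m<k} transport (legStepB kc K N) (n+m+1) (k−1−m) (rdiv ∘ F (n+m))` (part 3 re-based at level `n` by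
  `AffineUnroll.transport_shift`), and `rdiv_tower_window_chain` — the homogeneous term IS the pure chain on the block-summed member,
  `transport … n k (Δ n) = legChain kc K N n k (fun s ↦ bsumPow N k (Δ n s))` (part 3's `transport_legStepB_eq`).
* §2 `mem_rdiv_tower` (every member lies in any class `P` ∋ `Δ 0`, sources, closed under `+`, preserved by the step maps), **`sz_rdiv_tower_le_of_window`** — THE END: for ANY
  such class `P` and ANY `sz` with `sz (X + Y) ≤ sz X + sz Y`, IF (H1) `sz (legChain kc K N n k₀ (𝔹^{k₀} W)) ≤ θ·sz W` for every level `n` and bounded `W ∈ P` (`0 ≤ θ < 1`), (H2) the window's pushed sources have `sz ≤ s`, (H0) `sz (Δ i) ≤ M` for `i < k₀`, THEN `sz (Δ n) ≤ M + s·(1 − θ)⁻¹` for EVERY `n`;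
  `sz_rdiv_tower_le_of_window_bdd` (the bounded class: its four class rows are automatic), `…_of_rec` (from the affine recursion itself).
* §3 `sz_rdiv_tower_le_of_window_comb` — the dressed comb tower `K♮ᴱ_n`, `N = Lc`, `kc n = −(c n·(Lc^{d+1})⁻¹)`.
(H1) is DISPLAYED, NOT discharged: it is the located content of (Q-L) — idea-1's (Q-L-k₀) ∕ the desk's K-QL-1 ∕ the OWNER's E12 decide it; the size currency `sz` is the
consumer's ((WIN-k₀) ∕ (LT-leg)).  Asserts NO bound on any chain; discharges NOTHING of (Q-L) ∕ (Q-R) ∕ (C) ∕ «T2Shape» ∕ «T2Drift» ∕ (hW, hWall); 0 wall binders;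
NEVER «G-an2-4 closed» as (CONV-C); NOT D1, NOT `BetaPertH`, NOT continuum, NOT Clay; not in print.  Unit `b2b-balaban-gan24-formalise-leaf-03` (gen 60), 2026-08-22.
-/

noncomputable section
open Finset
open scoped BigOperators
open Literature.MathematicalPhysics.QuantumFieldTheory
open Literature.MathematicalPhysics.QuantumFieldTheory.Balaban1983to89
open Literature.MathematicalPhysics.QuantumFieldTheory.Balaban1983to89.Beta
open B6BondElimination (unitVec)
open ExpKernelCalculus (MKer Site Decays)
open OneStepResolventKernel (Fib)
open OneStepKernelFamily (colH KInvStep)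
open AffineAveraging (box toSite)
open Summit.QuantumFields.BalabanUV.Beta.KernelWardRelative (gaugeWt)
open Summit.QuantumFields.BalabanUV.Beta.GAN24.T2RecursionAffine (lin4)
open Summit.QuantumFields.BalabanUV.Beta.HessKerDressedUnits (unitK decays_unitK)
open Summit.QuantumFields.BalabanUV.Beta.GAN24.CombesThomas (sfStep smStep)
open Summit.QuantumFields.BalabanUV.Beta.AxialDressingRooted (coDressKBmAt one_le_of_neZero decays_coDressKBmAt_KInvStep)
open Summit.QuantumFields.BalabanUV.Beta.GAN24.Lin4SlotDivergence (hH_unitK_comb)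
open Summit.QuantumFields.BalabanUV.Beta.GAN24.Lin4LegDivergence (hM_unitK_comb)
open Summit.QuantumFields.BalabanUV.Beta.GAN24.Lin4LegTower (rdiv bsum legStep rdiv_lin4_affine)
open Summit.QuantumFields.BalabanUV.Beta.GAN24.Lin4LegTowerUnroll (legStepB bsumPow legChain rdiv_tower_unrolled transport_legStepB_eq)
open Summit.QuantumFields.BalabanUV.Beta.GAN24.AffineUnroll (transport transport_shift)
open Summit.QuantumFields.BalabanUV.Beta.GAN24.T2UnitSplitLevels (bdd₄_add)
open Summit.QuantumFields.BalabanUV.Beta.GAN24.TowerBoundKFold (towerBound_of_kfold)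

namespace Summit.QuantumFields.BalabanUV.Beta.GAN24.LegTowerRows

variable {d : ℕ} {N : ℕ} {kc : ℕ → ℝ} {K : ℕ → MKer (d + 1) (Fib d)}
  {T F : ℕ → Fin (d + 1) → (Fin (d + 1) → ℤ) → Fin (d + 1) → (Fin (d + 1) → ℤ) → MKer (d + 1) (Fib d)}

/-! ## §1 The k₀-window form of the leg tower -/

/-- [folklore] **THE WINDOW FORM** (part 3's unrolled form re-based at level `n`): if every `K m` decays, `T n` and every source are bounded, and the closed one-step
law holds at every level, then for every `n k`,
`Δ (n + k) = transport (legStepB kc K N) n k (Δ n) + Σ_{m<k} transport (legStepB kc K N) (n+m+1) (k−1−m) (rdiv ∘ F (n+m))`, `Δ i := fun s ↦ rdiv (T i s)`. -/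
theorem rdiv_tower_window (hK : ∀ m, ∃ δ C : ℝ, 0 < δ ∧ Decays (K m) C δ)
    (hT : ∀ m, ∃ B : ℝ, ∀ κ u κ' u' x z a b, |T m κ u κ' u' x z a b| ≤ B) (hF : ∀ m, ∃ B : ℝ, ∀ κ u κ' u' x z a b, |F m κ u κ' u' x z a b| ≤ B)
    (hstep : ∀ m κ u κ' u', rdiv (T (m + 1) κ u κ' u')
      = legStep (kc m) (K m) (K m) N (fun κ u κ' u' => bsum N (rdiv (T m κ u κ' u'))) κ u κ' u' + rdiv (F m κ u κ' u')) (n k : ℕ) :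
    (fun κ u κ' u' => rdiv (T (n + k) κ u κ' u'))
      = transport (legStepB kc K N) n k (fun κ u κ' u' => rdiv (T n κ u κ' u'))
        + ∑ m ∈ Finset.range k, transport (legStepB kc K N) (n + m + 1) (k - 1 - m) (fun κ u κ' u' => rdiv (F (n + m) κ u κ' u')) := by
  -- part 3 on the shifted tower `i ↦ T (i + n)`
  have h := rdiv_tower_unrolled (kc := fun i => kc (i + n)) (K := fun i => K (i + n)) (N := N) (T := fun i => T (i + n)) (F := fun i => F (i + n))
    (fun i => hK (i + n)) (hT n |>.imp fun B hB => by simpa using hB) (fun i => hF (i + n))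
    (fun i κ u κ' u' => by simpa [Nat.add_right_comm] using hstep (i + n) κ u κ' u') k
  have eA : (legStepB (fun i => kc (i + n)) (fun i => K (i + n)) N) = fun j => legStepB kc K N (j + n) := by
    funext j W
    rfl
  rw [eA, transport_shift] at h
  simp only [Nat.zero_add] at h
  rw [show n + k = k + n from Nat.add_comm n k, h]
  congr 1
  refine Finset.sum_congr rfl fun m _ => ?_
  rw [transport_shift, show n + m + 1 = m + 1 + n by omega, show n + m = m + n from Nat.add_comm n m]

/-- [folklore] **THE HOMOGENEOUS WINDOW TERM IS THE PURE CHAIN ON THE BLOCK-SUMMED MEMBER** (part 3's `transport_legStepB_eq`; bounded member):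
`transport (legStepB kc K N) n k (Δ n) = legChain kc K N n k (fun s ↦ bsumPow N k (Δ n s))`. -/
theorem rdiv_tower_window_chain (hK : ∀ m, ∃ δ C : ℝ, 0 < δ ∧ Decays (K m) C δ)
    (hT : ∀ m, ∃ B : ℝ, ∀ κ u κ' u' x z a b, |T m κ u κ' u' x z a b| ≤ B) (n k : ℕ) :
    transport (legStepB kc K N) n k (fun κ u κ' u' => rdiv (T n κ u κ' u'))
      = legChain kc K N n k (fun κ u κ' u' => bsumPow N k (rdiv (T n κ u κ' u'))) :=
  transport_legStepB_eq hK n k (Lin4LegTowerUnroll.bddTab_rdiv (hT n))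

/-- [folklore] **EVERY MEMBER OF THE LEG TOWER LIES IN ANY CLASS `P`** containing `Δ 0` and the source divergences, closed under `+`, and preserved by the step
maps `legStepB kc K N j` on bounded tables (leaf-01's `AffineUnroll.mem_of_rec` pattern; the bounded class itself is automatic, part 3). -/
theorem mem_rdiv_tower (hT : ∀ m, ∃ B : ℝ, ∀ κ u κ' u' x z a b, |T m κ u κ' u' x z a b| ≤ B)
    (hstep : ∀ m κ u κ' u', rdiv (T (m + 1) κ u κ' u')
      = legStep (kc m) (K m) (K m) N (fun κ u κ' u' => bsum N (rdiv (T m κ u κ' u'))) κ u κ' u' + rdiv (F m κ u κ' u'))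
    (P : (Fin (d + 1) → (Fin (d + 1) → ℤ) → Fin (d + 1) → (Fin (d + 1) → ℤ) → MKer (d + 1) (Fib d)) → Prop)
    (hP0 : P (fun κ u κ' u' => rdiv (T 0 κ u κ' u'))) (hPF : ∀ m, P (fun κ u κ' u' => rdiv (F m κ u κ' u')))
    (hPadd : ∀ X Y, P X → P Y → P (X + Y))
    (hPA : ∀ j (W : (Fin (d + 1) → (Fin (d + 1) → ℤ) → Fin (d + 1) → (Fin (d + 1) → ℤ) → MKer (d + 1) (Fib d))), P W →
      (∃ B : ℝ, ∀ κ u κ' u' x z a b, |W κ u κ' u' x z a b| ≤ B) → P (legStepB kc K N j W)) (m : ℕ) :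
    P (fun κ u κ' u' => rdiv (T m κ u κ' u')) := by
  induction m with
  | zero => exact hP0
  | succ m ih =>
    have e : (fun κ u κ' u' => rdiv (T (m + 1) κ u κ' u'))
        = legStepB kc K N m (fun κ u κ' u' => rdiv (T m κ u κ' u')) + fun κ u κ' u' => rdiv (F m κ u κ' u') := by
      funext κ u κ' u'
      rw [hstep m κ u κ' u']
      rfl
    rw [e]
    exact hPadd _ _ (hPA m _ ih (Lin4LegTowerUnroll.bddTab_rdiv (hT m))) (hPF m)

/-! ## §2 The END: the tower is bounded uniformly in the level, modulo the displayed k₀-window hypothesis -/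

/-- NOT IN PRINT; OUR BOOKKEEPING.  **THE (Q-L) END, STATEMENT FIRST.**  Let `P` be ANY class of bi-tables containing `Δ 0` and the source divergences, closed under `+`
and preserved by the step maps on bounded tables (e.g. ALL tables; or a fixed-rate `LocStencil`-type class — then `hPA` is the (LAY-leg) locality of the push), and let
`sz` be ANY size functional that is subadditive (`hsz`).  Suppose the leg tower
`Δ n := fun s ↦ rdiv (T n s)` of an affine `lin4` recursion obeys the closed one-step law at every level (`hstep` — part 1's `rdiv_lin4_affine`), all kernels decay, all members
and sources are bounded.  IF
(H1) **THE k₀-WINDOW HYPOTHESIS** ((WIN-k₀) ∧ (LT-leg) combined; OPEN — the located content of (Q-L)): the k₀-fold PURE leg chain contracts on k₀-fold block-summed bounded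
tables OF THE CLASS `P`, `sz (legChain kc K N n k₀ (fun s ↦ bsumPow N k₀ (W s))) ≤ θ · sz W` for every level `n`, with `0 ≤ θ < 1`;
(H2) the window's pushed sources are bounded, `sz (Σ_{m<k₀} transport (legStepB kc K N) (n+m+1) (k₀−1−m) (rdiv ∘ F (n+m))) ≤ s` for every `n` (`0 ≤ s`);
(H0) `sz (Δ i) ≤ M` on the first window `i < k₀` (`0 ≤ M`);
THEN `sz (Δ n) ≤ M + s·(1 − θ)⁻¹` for EVERY level `n` — the OWNER's `TowerBoundKFold.towerBound_of_kfold` on `a n := sz (Δ n)`.  Nothing of (H1) is claimed here. -/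
theorem sz_rdiv_tower_le_of_window (hK : ∀ m, ∃ δ C : ℝ, 0 < δ ∧ Decays (K m) C δ)
    (hT : ∀ m, ∃ B : ℝ, ∀ κ u κ' u' x z a b, |T m κ u κ' u' x z a b| ≤ B) (hF : ∀ m, ∃ B : ℝ, ∀ κ u κ' u' x z a b, |F m κ u κ' u' x z a b| ≤ B)
    (hstep : ∀ m κ u κ' u', rdiv (T (m + 1) κ u κ' u')
      = legStep (kc m) (K m) (K m) N (fun κ u κ' u' => bsum N (rdiv (T m κ u κ' u'))) κ u κ' u' + rdiv (F m κ u κ' u'))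
    (P : (Fin (d + 1) → (Fin (d + 1) → ℤ) → Fin (d + 1) → (Fin (d + 1) → ℤ) → MKer (d + 1) (Fib d)) → Prop)
    (hP0 : P (fun κ u κ' u' => rdiv (T 0 κ u κ' u'))) (hPF : ∀ m, P (fun κ u κ' u' => rdiv (F m κ u κ' u')))
    (hPadd : ∀ X Y, P X → P Y → P (X + Y))
    (hPA : ∀ j (W : (Fin (d + 1) → (Fin (d + 1) → ℤ) → Fin (d + 1) → (Fin (d + 1) → ℤ) → MKer (d + 1) (Fib d))), P W →
      (∃ B : ℝ, ∀ κ u κ' u' x z a b, |W κ u κ' u' x z a b| ≤ B) → P (legStepB kc K N j W))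
    (sz : (Fin (d + 1) → (Fin (d + 1) → ℤ) → Fin (d + 1) → (Fin (d + 1) → ℤ) → MKer (d + 1) (Fib d)) → ℝ)
    (hsz : ∀ X Y, sz (X + Y) ≤ sz X + sz Y)
    {k₀ : ℕ} (hk : 0 < k₀) {θ s M : ℝ} (hθ0 : 0 ≤ θ) (hθ1 : θ < 1) (hs : 0 ≤ s) (hM : 0 ≤ M)
    (H1 : ∀ n (W : (Fin (d + 1) → (Fin (d + 1) → ℤ) → Fin (d + 1) → (Fin (d + 1) → ℤ) → MKer (d + 1) (Fib d))), P W →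
      (∃ B : ℝ, ∀ κ u κ' u' x z a b, |W κ u κ' u' x z a b| ≤ B) →
        sz (legChain kc K N n k₀ (fun κ u κ' u' => bsumPow N k₀ (W κ u κ' u'))) ≤ θ * sz W)
    (H2 : ∀ n, sz (∑ m ∈ Finset.range k₀, transport (legStepB kc K N) (n + m + 1) (k₀ - 1 - m) (fun κ u κ' u' => rdiv (F (n + m) κ u κ' u'))) ≤ s)
    (H0 : ∀ i, i < k₀ → sz (fun κ u κ' u' => rdiv (T i κ u κ' u')) ≤ M) (n : ℕ) :
    sz (fun κ u κ' u' => rdiv (T n κ u κ' u')) ≤ M + s * (1 - θ)⁻¹ := by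
  refine towerBound_of_kfold (a := fun i => sz (fun κ u κ' u' => rdiv (T i κ u κ' u'))) hk hθ0 hθ1 hs hM H0 (fun m => ?_) n
  -- the window step: `Δ (m + k₀) = chain (𝔹^{k₀} Δ m) + sources`, then subadditivity, (H1) on the member (in `P`, bounded), (H2)
  show sz (fun κ u κ' u' => rdiv (T (m + k₀) κ u κ' u')) ≤ θ * sz (fun κ u κ' u' => rdiv (T m κ u κ' u')) + s
  rw [rdiv_tower_window hK hT hF hstep m k₀, rdiv_tower_window_chain hK hT m k₀]
  exact (hsz _ _).trans (add_le_add (H1 m _ (mem_rdiv_tower hT hstep P hP0 hPF hPadd hPA m)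
    (Lin4LegTowerUnroll.bddTab_rdiv (hT m))) (H2 m))

/-- NOT IN PRINT; OUR BOOKKEEPING.  **THE (Q-L) END ON THE BOUNDED CLASS** (`P :=` «entrywise bounded»: the four class rows `hP0 ∕ hPF ∕ hPadd ∕ hPA` are then
AUTOMATIC — part 3's `bddTab_rdiv` ∕ leaf-01's `bdd₄_add` ∕ part 3's `bddTab_legStepB` — so only (H1) on bounded tables, (H2) and (H0) remain; this is v1's statement, now a
corollary of the class form). -/
theorem sz_rdiv_tower_le_of_window_bdd (hK : ∀ m, ∃ δ C : ℝ, 0 < δ ∧ Decays (K m) C δ)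
    (hT : ∀ m, ∃ B : ℝ, ∀ κ u κ' u' x z a b, |T m κ u κ' u' x z a b| ≤ B) (hF : ∀ m, ∃ B : ℝ, ∀ κ u κ' u' x z a b, |F m κ u κ' u' x z a b| ≤ B)
    (hstep : ∀ m κ u κ' u', rdiv (T (m + 1) κ u κ' u')
      = legStep (kc m) (K m) (K m) N (fun κ u κ' u' => bsum N (rdiv (T m κ u κ' u'))) κ u κ' u' + rdiv (F m κ u κ' u'))
    (sz : (Fin (d + 1) → (Fin (d + 1) → ℤ) → Fin (d + 1) → (Fin (d + 1) → ℤ) → MKer (d + 1) (Fib d)) → ℝ)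
    (hsz : ∀ X Y, sz (X + Y) ≤ sz X + sz Y)
    {k₀ : ℕ} (hk : 0 < k₀) {θ s M : ℝ} (hθ0 : 0 ≤ θ) (hθ1 : θ < 1) (hs : 0 ≤ s) (hM : 0 ≤ M)
    (H1 : ∀ n (W : (Fin (d + 1) → (Fin (d + 1) → ℤ) → Fin (d + 1) → (Fin (d + 1) → ℤ) → MKer (d + 1) (Fib d))),
      (∃ B : ℝ, ∀ κ u κ' u' x z a b, |W κ u κ' u' x z a b| ≤ B) →
        sz (legChain kc K N n k₀ (fun κ u κ' u' => bsumPow N k₀ (W κ u κ' u'))) ≤ θ * sz W)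
    (H2 : ∀ n, sz (∑ m ∈ Finset.range k₀, transport (legStepB kc K N) (n + m + 1) (k₀ - 1 - m) (fun κ u κ' u' => rdiv (F (n + m) κ u κ' u'))) ≤ s)
    (H0 : ∀ i, i < k₀ → sz (fun κ u κ' u' => rdiv (T i κ u κ' u')) ≤ M) (n : ℕ) :
    sz (fun κ u κ' u' => rdiv (T n κ u κ' u')) ≤ M + s * (1 - θ)⁻¹ :=
  sz_rdiv_tower_le_of_window hK hT hF hstep
    (fun W => ∃ B : ℝ, ∀ κ u κ' u' x z a b, |W κ u κ' u' x z a b| ≤ B)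
    (Lin4LegTowerUnroll.bddTab_rdiv (hT 0)) (fun m => Lin4LegTowerUnroll.bddTab_rdiv (hF m)) (fun _ _ hX hY => bdd₄_add hX hY)
    (fun j _ hW _ => Lin4LegTowerUnroll.bddTab_legStepB hK j hW) sz hsz hk hθ0 hθ1 hs hM (fun n W hW _ => H1 n W hW) H2 H0 n

/-- NOT IN PRINT; OUR BOOKKEEPING.  **THE (Q-L) END FROM THE AFFINE RECURSION ITSELF**: `T (m+1) = lin4 (c m) (K m) N (T m) + F m` with (hH m) (constants `cH m`), (hMf m),
`N ≥ 1`, `T 0` and the sources bounded (every member is then bounded by leaf-01's `lin4_bdd`; `hstep` by part 1's `rdiv_lin4_affine`), `kc m = −(c m·cH m)`. -/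
theorem sz_rdiv_tower_le_of_window_of_rec {c cH : ℕ → ℝ} (hK : ∀ m, ∃ δ C : ℝ, 0 < δ ∧ Decays (K m) C δ) (hN : 1 ≤ N)
    (hT0 : ∃ B : ℝ, ∀ κ u κ' u' x z a b, |T 0 κ u κ' u' x z a b| ≤ B) (hF : ∀ m, ∃ B : ℝ, ∀ κ u κ' u' x z a b, |F m κ u κ' u' x z a b| ≤ B)
    (hrec : ∀ m, T (m + 1) = lin4 (c m) (K m) N (T m) + F m)
    (hH : ∀ m (y : Site (d + 1)) (κ : Fin (d + 1)) (u : Site (d + 1)),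
      ∑ μ, (colH (K m) N μ (y - unitVec μ) κ u - colH (K m) N μ y κ u) = cH m * gaugeWt N y κ u)
    (hMf : ∀ m (y x₂ : Site (d + 1)) (ρ : Fin (d + 1)),
      ∑ μ, (K m x₂ ((N : ℤ) • (y - unitVec μ)) (Sum.inr ρ) (Sum.inr μ) - K m x₂ ((N : ℤ) • y) (Sum.inr ρ) (Sum.inr μ)) = 0)
    (P : (Fin (d + 1) → (Fin (d + 1) → ℤ) → Fin (d + 1) → (Fin (d + 1) → ℤ) → MKer (d + 1) (Fib d)) → Prop)
    (hP0 : P (fun κ u κ' u' => rdiv (T 0 κ u κ' u'))) (hPF : ∀ m, P (fun κ u κ' u' => rdiv (F m κ u κ' u')))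
    (hPadd : ∀ X Y, P X → P Y → P (X + Y))
    (hPA : ∀ j (W : (Fin (d + 1) → (Fin (d + 1) → ℤ) → Fin (d + 1) → (Fin (d + 1) → ℤ) → MKer (d + 1) (Fib d))), P W →
      (∃ B : ℝ, ∀ κ u κ' u' x z a b, |W κ u κ' u' x z a b| ≤ B) → P (legStepB (fun m => -(c m * cH m)) K N j W))
    (sz : (Fin (d + 1) → (Fin (d + 1) → ℤ) → Fin (d + 1) → (Fin (d + 1) → ℤ) → MKer (d + 1) (Fib d)) → ℝ)
    (hsz : ∀ X Y, sz (X + Y) ≤ sz X + sz Y)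
    {k₀ : ℕ} (hk : 0 < k₀) {θ s M : ℝ} (hθ0 : 0 ≤ θ) (hθ1 : θ < 1) (hs : 0 ≤ s) (hM : 0 ≤ M)
    (H1 : ∀ n (W : (Fin (d + 1) → (Fin (d + 1) → ℤ) → Fin (d + 1) → (Fin (d + 1) → ℤ) → MKer (d + 1) (Fib d))), P W →
      (∃ B : ℝ, ∀ κ u κ' u' x z a b, |W κ u κ' u' x z a b| ≤ B) →
        sz (legChain (fun m => -(c m * cH m)) K N n k₀ (fun κ u κ' u' => bsumPow N k₀ (W κ u κ' u'))) ≤ θ * sz W)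
    (H2 : ∀ n, sz (∑ m ∈ Finset.range k₀, transport (legStepB (fun m => -(c m * cH m)) K N) (n + m + 1) (k₀ - 1 - m)
      (fun κ u κ' u' => rdiv (F (n + m) κ u κ' u'))) ≤ s)
    (H0 : ∀ i, i < k₀ → sz (fun κ u κ' u' => rdiv (T i κ u κ' u')) ≤ M) (n : ℕ) :
    sz (fun κ u κ' u' => rdiv (T n κ u κ' u')) ≤ M + s * (1 - θ)⁻¹ := by
  have hTb : ∀ m, ∃ B : ℝ, ∀ κ u κ' u' x z a b, |T m κ u κ' u' x z a b| ≤ B := by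
    intro m
    induction m with
    | zero => exact hT0
    | succ m ih =>
      obtain ⟨δ, C, hδ, hKm⟩ := hK m
      rw [hrec m]
      exact bdd₄_add (Lin4Additive.lin4_bdd hKm hδ (c m) N ih) (hF m)
  refine sz_rdiv_tower_le_of_window hK hTb hF (fun m κ u κ' u' => ?_) P hP0 hPF hPadd hPA sz hsz hk hθ0 hθ1 hs hM H1 H2 H0 n
  obtain ⟨δ, C, hδ, hKm⟩ := hK m
  obtain ⟨B, hB⟩ := hTb m
  rw [hrec m]
  exact rdiv_lin4_affine hKm hδ hN (c m) hB (hH m) (hMf m) (F m) κ u κ' u'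

/-! ## §3 The comb ∕ wall instance -/

section Comb

variable {Lc : ℕ} [NeZero Lc] {r : ℕ → Fin (d + 1) → ℕ}

/-- NOT IN PRINT; OUR BOOKKEEPING.  **THE (Q-L) END FOR THE DRESSED COMB TOWER** `K♮ᴱ_m = unitK (sfStep Lc m) (smStep d Lc m) (coDressKBmAt (toSite (r m)) Lc (KInvStep Lc m))`
(`N = Lc`, couplings `c m`, `kc m = −(c m·(Lc^{d+1})⁻¹)`): modulo (H1) ∕ (H2) ∕ (H0) in the consumer's size `sz`, `sz (Δ n) ≤ M + s·(1 − θ)⁻¹` for every level. -/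
theorem sz_rdiv_tower_le_of_window_comb (hr : ∀ m, r m ∈ box (d + 1) Lc) (c : ℕ → ℝ)
    {T F : ℕ → Fin (d + 1) → (Fin (d + 1) → ℤ) → Fin (d + 1) → (Fin (d + 1) → ℤ) → MKer (d + 1) (Fib d)}
    (hT0 : ∃ B : ℝ, ∀ κ u κ' u' x z a b, |T 0 κ u κ' u' x z a b| ≤ B) (hF : ∀ m, ∃ B : ℝ, ∀ κ u κ' u' x z a b, |F m κ u κ' u' x z a b| ≤ B)
    (hrec : ∀ m, T (m + 1) = lin4 (c m) (unitK (sfStep Lc m) (smStep d Lc m) (coDressKBmAt (toSite (r m)) Lc (KInvStep (d := d) Lc m))) Lc (T m) + F m)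
    (P : (Fin (d + 1) → (Fin (d + 1) → ℤ) → Fin (d + 1) → (Fin (d + 1) → ℤ) → MKer (d + 1) (Fib d)) → Prop)
    (hP0 : P (fun κ u κ' u' => rdiv (T 0 κ u κ' u'))) (hPF : ∀ m, P (fun κ u κ' u' => rdiv (F m κ u κ' u')))
    (hPadd : ∀ X Y, P X → P Y → P (X + Y))
    (hPA : ∀ j (W : (Fin (d + 1) → (Fin (d + 1) → ℤ) → Fin (d + 1) → (Fin (d + 1) → ℤ) → MKer (d + 1) (Fib d))), P W →
      (∃ B : ℝ, ∀ κ u κ' u' x z a b, |W κ u κ' u' x z a b| ≤ B) →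
        P (legStepB (fun m => -(c m * ((Lc : ℝ) ^ (d + 1))⁻¹))
          (fun m => unitK (sfStep Lc m) (smStep d Lc m) (coDressKBmAt (toSite (r m)) Lc (KInvStep (d := d) Lc m))) Lc j W))
    (sz : (Fin (d + 1) → (Fin (d + 1) → ℤ) → Fin (d + 1) → (Fin (d + 1) → ℤ) → MKer (d + 1) (Fib d)) → ℝ)
    (hsz : ∀ X Y, sz (X + Y) ≤ sz X + sz Y)
    {k₀ : ℕ} (hk : 0 < k₀) {θ s M : ℝ} (hθ0 : 0 ≤ θ) (hθ1 : θ < 1) (hs : 0 ≤ s) (hM : 0 ≤ M)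
    (H1 : ∀ n (W : (Fin (d + 1) → (Fin (d + 1) → ℤ) → Fin (d + 1) → (Fin (d + 1) → ℤ) → MKer (d + 1) (Fib d))), P W →
      (∃ B : ℝ, ∀ κ u κ' u' x z a b, |W κ u κ' u' x z a b| ≤ B) →
        sz (legChain (fun m => -(c m * ((Lc : ℝ) ^ (d + 1))⁻¹))
          (fun m => unitK (sfStep Lc m) (smStep d Lc m) (coDressKBmAt (toSite (r m)) Lc (KInvStep (d := d) Lc m))) Lc n k₀
          (fun κ u κ' u' => bsumPow Lc k₀ (W κ u κ' u'))) ≤ θ * sz W)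
    (H2 : ∀ n, sz (∑ m ∈ Finset.range k₀, transport (legStepB (fun m => -(c m * ((Lc : ℝ) ^ (d + 1))⁻¹))
      (fun m => unitK (sfStep Lc m) (smStep d Lc m) (coDressKBmAt (toSite (r m)) Lc (KInvStep (d := d) Lc m))) Lc) (n + m + 1) (k₀ - 1 - m)
      (fun κ u κ' u' => rdiv (F (n + m) κ u κ' u'))) ≤ s)
    (H0 : ∀ i, i < k₀ → sz (fun κ u κ' u' => rdiv (T i κ u κ' u')) ≤ M) (n : ℕ) :
    sz (fun κ u κ' u' => rdiv (T n κ u κ' u')) ≤ M + s * (1 - θ)⁻¹ := by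
  have hK : ∀ m, ∃ δ C : ℝ, 0 < δ ∧ Decays (unitK (sfStep Lc m) (smStep d Lc m) (coDressKBmAt (toSite (r m)) Lc (KInvStep (d := d) Lc m))) C δ := by
    intro m
    obtain ⟨δK, CK, hδK, -, hG⟩ := decays_coDressKBmAt_KInvStep (d := d) (hr m) m
    exact ⟨δK, _, hδK, decays_unitK hG⟩
  exact sz_rdiv_tower_le_of_window_of_rec (cH := fun _ => ((Lc : ℝ) ^ (d + 1))⁻¹) hK (one_le_of_neZero Lc) hT0 hF hrec
    (fun m => hH_unitK_comb (hr m) m) (fun m => hM_unitK_comb m) P hP0 hPF hPadd hPA sz hsz hk hθ0 hθ1 hs hM H1 H2 H0 n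

end Comb

end Summit.QuantumFields.BalabanUV.Beta.GAN24.LegTowerRows
end
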